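import Mathlib.Analysis.Calculus.BumpFunction.Convolution
import Mathlib.Analysis.Calculus.BumpFunction.FiniteDimension
import Mathlib.Analysis.Calculus.ContDiff.Convolution
import Mathlib.MeasureTheory.Measure.Haar.Unique
import Literature.Analysis.SingularIntegrals.HardyLittlewoodMaximal
import HarnessLib

/-!
# Mollification over a general additive Haar measure: Lipschitz and maximal-function bounds

Elementary facts about `f_ε = ρ_ε ⋆ f` for the normalised bump `ρ_ε` (`= c` on `B(0, ε/2)`,
supported in `B(0, ε)`, `∫ρ_ε dμ = 1`) on a finite-dimensional real normed space with an
additive Haar measure `μ` (Mathlib's `ContDiffBump.normed μ` and `MeasureTheory.convolution`).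

**Relation to the tree.** `Literature/Analysis/Convolution/ScaledMollifier.lean` already
provides `Literature.Analysis.Convolution.mollify ε f = (mollBump E ε).normed volume ⋆ f` with
its calculus (`contDiff_mollify`, `mollify_eq_self_of_ball`, `fderiv_mollify_apply_eq_mollify`,
…), but only for the Lebesgue measure `volume` on a finite-dimensional *inner product* space.
The Hardy–Littlewood maximal function of the tree
(`Literature.Analysis.SingularIntegrals.maximalFunction μ`, file `HardyLittlewoodMaximal.lean`)
lives over a *general additive Haar measure `μ` on a normed space*, and the maximal bound
`‖D(ρ_ε ⋆ u)‖ ≤ 2ⁿ M_μ(‖Du‖)` below needs the mollifier normalised with respect to the same `μ`.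
Hence the `μ`-versions `haarBump` / `haarMollify μ` here (names chosen not to clash with the
`volume` versions); the general-`μ` restatements are minimal and each points to its twin:

* `haarMollify_apply` (twin: `mollify_apply`), `contDiff_haarMollify` (`contDiff_mollify`),
  `hasCompactSupport_haarMollify`, `haarMollify_congr_ball` (`mollify_eq_self_of_ball` /
  locality), `fderiv_haarMollify_congr_ball`, `fderiv_haarMollify_apply`
  (`fderiv_mollify_apply_eq_mollify`);

and the genuinely new content:

* `lipschitzWith_haarMollify`, `norm_fderiv_haarMollify_le_of_lipschitz` — Lipschitz
  functions stay Lipschitz with the same constant, so `‖D(ρ_ε ⋆ f)‖ ≤ L`;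
* `norm_fderiv_haarMollify_le`, `ofReal_haarMollify_le_maximal`,
  `enorm_fderiv_haarMollify_le_maximal` — for `C¹_c` functions
  `‖D(ρ_ε ⋆ u)(x)‖ ≤ (ρ_ε ⋆ ‖Du‖)(x) ≤ 2ⁿ M_μ(‖Du‖)(x)`.

These serve the Lipschitz truncation of [Badr2009, §5 Prop. 5.6] in smooth form.

## References

* [Badr2009] N. Badr, *Real interpolation of Sobolev spaces*, Math. Scand. 105 (2009), §5.
-/

noncomputable section

open MeasureTheory Metric Set Filter Topology Module ContinuousLinearMap
open scoped ENNReal NNReal Convolution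

namespace Literature.Analysis.FunctionSpaces

open Literature.Analysis.SingularIntegrals

universe u

variable {E : Type u} [NormedAddCommGroup E] [NormedSpace ℝ E] [FiniteDimensional ℝ E]
  [MeasurableSpace E] [BorelSpace E] (μ : Measure E) [μ.IsAddHaarMeasure]

/-! ### The mollifier -/

/-- The bump of radii `ε/2 < ε` at the origin (for `ε > 0`; for `ε ≤ 0` the junk radii `1 < 2`);
twin of `Literature.Analysis.Convolution.mollBump` (radii `ε < 2ε`). [folklore] -/
def haarBump (ε : ℝ) : ContDiffBump (0 : E) :=
  if h : 0 < ε then ⟨ε / 2, ε, half_pos h, half_lt_self h⟩ else ⟨1, 2, one_pos, one_lt_two⟩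

omit [NormedSpace ℝ E] [FiniteDimensional ℝ E] [MeasurableSpace E] [BorelSpace E] in
/-- Outer radius of `haarBump ε`. [folklore] -/
theorem haarBump_rOut {ε : ℝ} (hε : 0 < ε) : (haarBump (E := E) ε).rOut = ε := by
  simp [haarBump, hε]

omit [NormedSpace ℝ E] [FiniteDimensional ℝ E] [MeasurableSpace E] [BorelSpace E] in
/-- Inner radius of `haarBump ε`. [folklore] -/
theorem haarBump_rIn {ε : ℝ} (hε : 0 < ε) : (haarBump (E := E) ε).rIn = ε / 2 := by
  simp [haarBump, hε]

/-- The mollification `f_ε = ρ_ε ⋆ f` with `ρ_ε = (haarBump ε).normed μ` normalised w.r.t. the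
Haar measure `μ`; twin of the `volume`-only `Literature.Analysis.Convolution.mollify`.
[folklore] -/
def haarMollify (ε : ℝ) (f : E → ℝ) : E → ℝ :=
  (haarBump ε).normed μ ⋆[lsmul ℝ ℝ, μ] f

omit [BorelSpace E] [μ.IsAddHaarMeasure] in
/-- Unfolding `haarMollify` (twin: `Literature.Analysis.Convolution.mollify_apply`). [folklore] -/
theorem haarMollify_apply (ε : ℝ) (f : E → ℝ) (x : E) :
    haarMollify μ ε f x = ∫ t, (haarBump ε).normed μ t * f (x - t) ∂μ := by
  rw [haarMollify, convolution_def]; rfl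

/-! ### Smoothness, support -/

/-- `ρ_ε ⋆ f` is smooth for locally integrable `f` (twin: `contDiff_mollify`). [folklore] -/
theorem contDiff_haarMollify (ε : ℝ) {f : E → ℝ} (hf : LocallyIntegrable f μ) {n : ℕ∞} :
    ContDiff ℝ n (haarMollify μ ε f) :=
  (haarBump ε).hasCompactSupport_normed.contDiff_convolution_left _ (haarBump ε).contDiff_normed hf

/-- `ρ_ε ⋆ f` has compact support for compactly supported `f`
(twin: `hasCompactSupport_mollify`). [folklore] -/
theorem hasCompactSupport_haarMollify (ε : ℝ) {f : E → ℝ} (hf : HasCompactSupport f) :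
    HasCompactSupport (haarMollify μ ε f) :=
  (haarBump ε).hasCompactSupport_normed.convolution _ hf

/-! ### Locality -/

/-- If `f = g` on `B(x, ε)` then `(ρ_ε ⋆ f)(x) = (ρ_ε ⋆ g)(x)` (locality; twin:
`mollify_eq_self_of_ball`). [folklore] -/
theorem haarMollify_congr_ball {ε : ℝ} (hε : 0 < ε) {f g : E → ℝ} {x : E}
    (h : ∀ y ∈ ball x ε, f y = g y) : haarMollify μ ε f x = haarMollify μ ε g x := by
  rw [haarMollify_apply, haarMollify_apply]
  refine integral_congr_ae (Eventually.of_forall fun t => ?_)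
  by_cases ht : (haarBump (E := E) ε).normed μ t = 0
  · simp only [ht, zero_mul]
  · have hts : t ∈ Function.support ((haarBump (E := E) ε).normed μ) := ht
    rw [(haarBump (E := E) ε).support_normed_eq, haarBump_rOut hε, mem_ball_zero_iff] at hts
    show (haarBump ε).normed μ t * f (x - t) = (haarBump ε).normed μ t * g (x - t)
    rw [h (x - t) (by rw [mem_ball, dist_eq_norm, sub_sub_cancel_left, norm_neg]; exact hts)]

/-- If `f = g` on `B(x, 2ε)` then `D(ρ_ε ⋆ f)(x) = D(ρ_ε ⋆ g)(x)`. [folklore] -/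
theorem fderiv_haarMollify_congr_ball {ε : ℝ} (hε : 0 < ε) {f g : E → ℝ} {x : E}
    (h : ∀ y ∈ ball x (2 * ε), f y = g y) :
    fderiv ℝ (haarMollify μ ε f) x = fderiv ℝ (haarMollify μ ε g) x := by
  refine Filter.EventuallyEq.fderiv_eq ?_
  filter_upwards [ball_mem_nhds x hε] with x' hx'
  refine haarMollify_congr_ball μ hε fun y hy => h y ?_
  rw [mem_ball] at hx' hy ⊢
  calc dist y x ≤ dist y x' + dist x' x := dist_triangle _ _ _
    _ < ε + ε := add_lt_add hy hx'
    _ = 2 * ε := by ring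

/-! ### Lipschitz functions -/

/-- The convolution integrand `ρ_ε(t) f(x - t)` is integrable for continuous `f`. [folklore] -/
theorem integrable_haarMollify_integrand (ε : ℝ) {f : E → ℝ} (hf : Continuous f) (x : E) :
    Integrable (fun t => (haarBump ε).normed μ t * f (x - t)) μ :=
  (haarBump ε).hasCompactSupport_normed.convolutionExists_left (lsmul ℝ ℝ)
    (haarBump ε).continuous_normed hf.locallyIntegrable x

/-- Mollification preserves Lipschitz constants. [folklore] -/
theorem lipschitzWith_haarMollify (ε : ℝ) {f : E → ℝ} {L : ℝ≥0} (hf : LipschitzWith L f) :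
    LipschitzWith L (haarMollify μ ε f) := by
  have hfc : Continuous f := hf.continuous
  refine LipschitzWith.of_dist_le_mul fun x x' => ?_
  rw [Real.dist_eq, haarMollify_apply, haarMollify_apply,
    ← integral_sub (integrable_haarMollify_integrand μ ε hfc x)
      (integrable_haarMollify_integrand μ ε hfc x')]
  have hbound : ∀ t, ‖(haarBump ε).normed μ t * f (x - t) - (haarBump ε).normed μ t * f (x' - t)‖ ≤
      (haarBump ε).normed μ t * (L * dist x x') := fun t => by
    rw [← mul_sub, norm_mul, Real.norm_of_nonneg ((haarBump ε).nonneg_normed t)]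
    refine mul_le_mul_of_nonneg_left ?_ ((haarBump ε).nonneg_normed t)
    rw [Real.norm_eq_abs, ← Real.dist_eq]
    have := hf.dist_le_mul (x - t) (x' - t)
    rwa [dist_sub_right] at this
  calc |∫ t, (haarBump ε).normed μ t * f (x - t) - (haarBump ε).normed μ t * f (x' - t) ∂μ|
      ≤ ∫ t, (haarBump ε).normed μ t * (L * dist x x') ∂μ := by
        rw [← Real.norm_eq_abs]
        exact norm_integral_le_of_norm_le ((haarBump ε).integrable_normed.mul_const _)
          (Eventually.of_forall hbound)
    _ = L * dist x x' := by rw [integral_mul_const, (haarBump ε).integral_normed, one_mul]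

/-- `‖D(ρ_ε ⋆ f)‖ ≤ L` for `L`-Lipschitz `f`. [folklore] -/
theorem norm_fderiv_haarMollify_le_of_lipschitz (ε : ℝ) {f : E → ℝ} {L : ℝ≥0}
    (hf : LipschitzWith L f) (x : E) : ‖fderiv ℝ (haarMollify μ ε f) x‖ ≤ L :=
  norm_fderiv_le_of_lipschitz ℝ (lipschitzWith_haarMollify μ ε hf)

/-! ### `C¹` functions: `D(ρ_ε ⋆ u) = ρ_ε ⋆ Du` and the maximal bound -/

/-- The derivative of `ρ_ε ⋆ u` for `u ∈ C¹_c`, evaluated: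
`D(ρ_ε ⋆ u)(x) v = (ρ_ε ⋆ (Du · v))(x)` (twin: `fderiv_mollify_apply_eq_mollify`). [folklore] -/
theorem fderiv_haarMollify_apply (ε : ℝ) {u : E → ℝ} (hu : ContDiff ℝ 1 u)
    (hcu : HasCompactSupport u) (x v : E) :
    fderiv ℝ (haarMollify μ ε u) x v = haarMollify μ ε (fun w => fderiv ℝ u w v) x := by
  have hρ : LocallyIntegrable ((haarBump ε).normed μ) μ :=
    (haarBump ε).integrable_normed.locallyIntegrable
  have h := (hcu.hasFDerivAt_convolution_right (𝕜 := ℝ) (L := lsmul ℝ ℝ) (μ := μ) hρ hu x).fderiv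
  rw [haarMollify, h, convolution_precompR_apply (𝕜 := ℝ) (L := lsmul ℝ ℝ) hρ (hcu.fderiv ℝ)
    (hu.continuous_fderiv one_ne_zero)]
  rfl

/-- `‖D(ρ_ε ⋆ u)(x)‖ ≤ (ρ_ε ⋆ ‖Du‖)(x)` for `u ∈ C¹_c`. [folklore] -/
theorem norm_fderiv_haarMollify_le (ε : ℝ) {u : E → ℝ} (hu : ContDiff ℝ 1 u)
    (hcu : HasCompactSupport u) (x : E) :
    ‖fderiv ℝ (haarMollify μ ε u) x‖ ≤ haarMollify μ ε (fun w => ‖fderiv ℝ u w‖) x := by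
  have hDc : Continuous (fderiv ℝ u) := hu.continuous_fderiv one_ne_zero
  have hnn : 0 ≤ haarMollify μ ε (fun w => ‖fderiv ℝ u w‖) x := by
    rw [haarMollify_apply]
    exact integral_nonneg fun t => mul_nonneg ((haarBump ε).nonneg_normed t) (norm_nonneg _)
  refine ContinuousLinearMap.opNorm_le_bound _ hnn fun v => ?_
  rw [fderiv_haarMollify_apply μ ε hu hcu x v, haarMollify_apply, haarMollify_apply,
    ← integral_mul_const]
  refine norm_integral_le_of_norm_le ((integrable_haarMollify_integrand μ ε hDc.norm x).mul_const _)
    (Eventually.of_forall fun t => ?_)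
  rw [norm_mul, Real.norm_of_nonneg ((haarBump ε).nonneg_normed t), mul_assoc]
  exact mul_le_mul_of_nonneg_left ((fderiv ℝ u (x - t)).le_opNorm v) ((haarBump ε).nonneg_normed t)

/-- `(ρ_ε ⋆ F)(x) ≤ 2ⁿ M(F)(x)` for continuous `F ≥ 0` (`sup ρ_ε ≤ 1/μ(B(0, ε/2))`,
`supp ρ_ε ⊆ B(0, ε)`, `μ(B(x, ε)) = 2ⁿ μ(B(0, ε/2))`). [folklore] -/
theorem ofReal_haarMollify_le_maximal {ε : ℝ} (hε : 0 < ε) {F : E → ℝ} (hF : Continuous F)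
    (hF0 : ∀ w, 0 ≤ F w) (x : E) :
    ENNReal.ofReal (haarMollify μ ε F x) ≤
      2 ^ finrank ℝ E * maximalFunction μ (fun w => ENNReal.ofReal (F w)) x := by
  set n := finrank ℝ E with hn
  set ρ := (haarBump (E := E) ε).normed μ with hρdef
  have hρ0 : ∀ t, 0 ≤ ρ t := fun t => (haarBump ε).nonneg_normed t
  have hε2 : 0 < ε / 2 := half_pos hε
  have hb0 : μ (ball (0 : E) (ε / 2)) ≠ 0 := (measure_ball_pos μ 0 hε2).ne'
  have hbt : μ (ball (0 : E) (ε / 2)) ≠ ⊤ := measure_ball_lt_top.ne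
  -- `ρ ≤ c 𝟙_{B(0,ε)}` with `c = μ(B(0, ε/2))⁻¹`
  have hρle : ∀ t, ENNReal.ofReal (ρ t) ≤
      (ball (0 : E) ε).indicator (fun _ => (μ (ball (0 : E) (ε / 2)))⁻¹) t := by
    intro t
    by_cases ht : t ∈ ball (0 : E) ε
    · rw [indicator_of_mem ht]
      have h1 := (haarBump (E := E) ε).normed_le_div_measure_closedBall_rIn (μ := μ) t
      rw [haarBump_rIn hε] at h1
      calc ENNReal.ofReal (ρ t) ≤ ENNReal.ofReal (1 / μ.real (closedBall (0 : E) (ε / 2))) :=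
            ENNReal.ofReal_le_ofReal h1
        _ ≤ ENNReal.ofReal (1 / μ.real (ball (0 : E) (ε / 2))) := by
            refine ENNReal.ofReal_le_ofReal (one_div_le_one_div_of_le ?_ ?_)
            · exact ENNReal.toReal_pos hb0 hbt
            · exact ENNReal.toReal_mono measure_closedBall_lt_top.ne
                (measure_mono ball_subset_closedBall)
        _ = (μ (ball (0 : E) (ε / 2)))⁻¹ := by
            rw [one_div, measureReal_def, ENNReal.ofReal_inv_of_pos (ENNReal.toReal_pos hb0 hbt),
              ENNReal.ofReal_toReal hbt]
    · rw [indicator_of_notMem ht]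
      have : ρ t = 0 := by
        have hts : t ∉ Function.support ρ := by
          rw [hρdef, (haarBump (E := E) ε).support_normed_eq, haarBump_rOut hε]; exact ht
        simpa [Function.mem_support] using hts
      simp [this]
  -- pass to `ℝ≥0∞`
  have hint : Integrable (fun t => ρ t * F (x - t)) μ := integrable_haarMollify_integrand μ ε hF x
  rw [haarMollify_apply, ofReal_integral_eq_lintegral_ofReal hint
    (Eventually.of_forall fun t => mul_nonneg (hρ0 t) (hF0 _))]
  simp_rw [ENNReal.ofReal_mul (hρ0 _)]
  calc ∫⁻ t, ENNReal.ofReal (ρ t) * ENNReal.ofReal (F (x - t)) ∂μ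
      ≤ ∫⁻ t, (ball (0 : E) ε).indicator (fun _ => (μ (ball (0 : E) (ε / 2)))⁻¹) t *
          ENNReal.ofReal (F (x - t)) ∂μ := lintegral_mono fun t => mul_le_mul_left (hρle t) _
    _ = ∫⁻ t, (ball x ε).indicator (fun w => (μ (ball (0 : E) (ε / 2)))⁻¹ *
          ENNReal.ofReal (F w)) (x - t) ∂μ := by
        refine lintegral_congr fun t => ?_
        by_cases ht : t ∈ ball (0 : E) ε
        · have : x - t ∈ ball x ε := by
            rw [mem_ball, dist_eq_norm, sub_sub_cancel_left, norm_neg]; exact mem_ball_zero_iff.1 ht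
          rw [indicator_of_mem ht, indicator_of_mem this]
        · have : x - t ∉ ball x ε := by
            rw [mem_ball, dist_eq_norm, sub_sub_cancel_left, norm_neg, ← mem_ball_zero_iff]
            exact ht
          rw [indicator_of_notMem ht, indicator_of_notMem this, zero_mul]
    _ = ∫⁻ w, (ball x ε).indicator (fun w => (μ (ball (0 : E) (ε / 2)))⁻¹ *
          ENNReal.ofReal (F w)) w ∂μ := lintegral_sub_left_eq_self _ x
    _ = (μ (ball (0 : E) (ε / 2)))⁻¹ * ∫⁻ w in ball x ε, ENNReal.ofReal (F w) ∂μ := by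
        rw [lintegral_indicator measurableSet_ball,
          lintegral_const_mul' _ _ (ENNReal.inv_ne_top.2 hb0)]
    _ ≤ (μ (ball (0 : E) (ε / 2)))⁻¹ *
          (maximalFunction μ (fun w => ENNReal.ofReal (F w)) x * μ (ball x ε)) :=
        mul_le_mul_right (setLIntegral_ball_le_maximalFunction_mul μ _ x hε) _
    _ = 2 ^ n * maximalFunction μ (fun w => ENNReal.ofReal (F w)) x := by
        have hsc : μ (ball x ε) = 2 ^ n * μ (ball (0 : E) (ε / 2)) := by
          have := measure_ball_mul_eq μ (0 : E) x (c := 2) two_pos (ε / 2)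
          rw [show (2 : ℝ) * (ε / 2) = ε by ring, ENNReal.ofReal_pow (by norm_num),
            ENNReal.ofReal_ofNat] at this
          exact this
        set V := μ (ball (0 : E) (ε / 2)) with hV
        set Mx := maximalFunction μ (fun w => ENNReal.ofReal (F w)) x with hMx
        rw [hsc, show V⁻¹ * (Mx * (2 ^ n * V)) = (V⁻¹ * V) * (2 ^ n * Mx) by ring,
          ENNReal.inv_mul_cancel hb0 hbt, one_mul]

/-- **`‖D(ρ_ε ⋆ u)(x)‖ ≤ 2ⁿ M(‖Du‖)(x)`** for `u ∈ C¹_c`, `ε > 0`. [folklore] -/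
theorem enorm_fderiv_haarMollify_le_maximal {ε : ℝ} (hε : 0 < ε) {u : E → ℝ} (hu : ContDiff ℝ 1 u)
    (hcu : HasCompactSupport u) (x : E) :
    ‖fderiv ℝ (haarMollify μ ε u) x‖ₑ ≤
      2 ^ finrank ℝ E * maximalFunction μ (fun w => ‖fderiv ℝ u w‖ₑ) x := by
  have hDc : Continuous (fderiv ℝ u) := hu.continuous_fderiv one_ne_zero
  rw [← ofReal_norm]
  calc ENNReal.ofReal ‖fderiv ℝ (haarMollify μ ε u) x‖
      ≤ ENNReal.ofReal (haarMollify μ ε (fun w => ‖fderiv ℝ u w‖) x) :=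
        ENNReal.ofReal_le_ofReal (norm_fderiv_haarMollify_le μ ε hu hcu x)
    _ ≤ 2 ^ finrank ℝ E * maximalFunction μ (fun w => ENNReal.ofReal ‖fderiv ℝ u w‖) x :=
        ofReal_haarMollify_le_maximal μ hε hDc.norm (fun w => norm_nonneg _) x
    _ = 2 ^ finrank ℝ E * maximalFunction μ (fun w => ‖fderiv ℝ u w‖ₑ) x := by
        simp_rw [ofReal_norm]

end Literature.Analysis.FunctionSpaces

end
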